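import Summits.QuantumFields.YangMills.Theorems.BalabanUVNodesN15KingModelCurvatureStaggered
import HarnessLib

/-!
# BalabanUVNodes ∕ N15 — THE KING-MODEL RUNG (PART Ϳ-e′): THE KOGUT–SUSSKIND BAND IS EXACT — on the `2^{d+1}` parity classes the anticommuting hoppings square to `4(d+1)`, so
# `w_± = Sv ± 2√(d+1)·v` are EXPLICIT eigenvectors: `spec(−cΔ_U+m²)` at the maximal-flux `ℤ₂` field has bottom EXACTLY `m² + (2(d+1)−2√(d+1))c` and top EXACTLY
# `m² + (2(d+1)+2√(d+1))c` (four dimensions: `[m²+4c, m²+12c]`)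
# (Track A, DAG node N15 = NE2; FAN-OUT v1.1 §N15 s3 «KING-MODEL RUNG … + what the curved case adds»; count-neutral)

HONEST FRAMING.  Count-neutral (cell `pub-ymgap`, seat `pub-ymgap-dag-n15-e` g46; `--supports stmt-QuantumFields-27247 --as helper` = K3ᴬ, KEY MAP v3).  King's fine covariance layer
`−cΔ_U+m²` (Ͱ-a `covLapF`) at the explicit Kogut–Susskind `ℤ₂` field of Ϳ-e on ONE finite torus with all periods even; elementary (a Clifford-type identity on parity-periodic
functions); NOT Bałaban's `G_k(U)`; NOT [Balaban1985BackgroundPropagators] (3.42); NOT a node discharge (N15 of record untouched); nothing continuum ∕ ℝ⁴ ∕ OS ∕ Clay.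

THE RESULTS (all `K_μ` even, any fibre `𝕜ⁿ`, `S = Σ_μT_μ` the KS hopping of Ϳ-e):
* §1 `ksTₗ` (the hopping as a linear map), `IsParityPeriodic v` (`v(x+2e_μ) = v(x)` for all `μ`), ★ `ksT_ksT_self` (`T_μ²v = 4v` on parity-periodic `v` — `η_μ` ignores `x_μ`),
  ★★ **`ksS_ksS`** (`S(Sv) = 4(d+1)·v` on parity-periodic `v`: the diagonal gives `Σ_μT_μ² = 4(d+1)`, the off-diagonal pairs cancel by Ϳ-e `ksT_anticomm`), `isParityPeriodic_ksS`;
* §2 ★★★ **`ksS_eigvec_plus`∕`_minus`** — `S(Sv ± 2√(d+1)v) = ±2√(d+1)·(Sv ± 2√(d+1)v)`; ★★★ **`covLapF_ks_mulVec_eigvec`** — `(−cΔ_U+m²)w_± = (m² + (2(d+1) ∓ 2√(d+1))c)·w_±`;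
* §3 the parity indicator `parInd e (x,i) = Π_μ(1 + (−1)^{x_μ})·e_i` (`2^{d+1}e` on the all-even class, `0` elsewhere) is parity-periodic, `Sv` vanishes on the all-even class, so `w_±(0) =
  ±2√(d+1)2^{d+1}e ≠ 0`; ★★★ **`exists_eigenvalue_covLapF_ks_eq_bottom`∕`_top`** and ★★★ **`ks_spectral_band_exact`** — with Ϳ-e's two-sided bounds: `min spec = m² + (2(d+1)−2√(d+1))c`,
  `max spec = m² + (2(d+1)+2√(d+1))c` EXACTLY (non-trivial fibre).
WHAT THE CURVED CASE ADDS (as theorems): at maximal `ℤ₂` curvature King's covariant kinetic band is EXACTLY `[2(d+1)−2√(d+1), 2(d+1)+2√(d+1)]·c` — the anticommutation bound of Ϳ-e is sharp at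
both ends, as the plaquette bound of Ϳ-b was at π-flux in two dimensions (Ϳ-d).
PRIOR TREE ART (by name, not restated): Ϳ-d (`subSgn`, `subSgn_add_unitVec_self`, `subSgn_sub_unitVec_self`, `subSgn_add_unitVec_of_ne`, `subSgn_sub_unitVec_of_ne`, `exists_eigenvalues_eq_of_mulVec`),
Ϳ-e (`ksSgn`, `ksT`, `ksT_apply`, `ksT_anticomm`, `ksSgn_add_unitVec_self`, `ksSgn_sub_unitVec_self`, `ksSgn_mul_self`, `ksLink`, `covLapF_ks_mulVec`, `eigenvalues_covLapF_ks_ge`∕`_le`), Ͱ-a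
(`covLapF`, `isHermitian_covLapF`).  Dedup (rg at filing): basename 0 files; needles `ksTₗ|IsParityPeriodic|ksS_ksS|ksS_eigvec_plus|parInd|ks_spectral_band_exact` 0 tree files.  Locators: [King1986]
(2.12) p.653, (4.4) p.670; [Balaban1985BackgroundPropagators] (3.23) p.394; [DodziukMathai2006] §1 Cor 1.3; [tHooft1979Flux] NPB 153 (flux sectors, notion).  0 `sorry`, 3 `def`.
-/

noncomputable section
open scoped BigOperators ComplexConjugate ComplexOrder
open Finset Matrix

namespace Summit.QuantumFields.YangMills.BalabanUVNodes.N15KingModelRung.Curvature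

open Literature.MathematicalPhysics.QuantumFieldTheory.Balaban1983to89.B5Prop11Plancherel (Tor unitVec)
open Summit.QuantumFields.YangMills.BalabanUVNodes.N15KingModelRung.Covariant (covLapF isHermitian_covLapF)

variable {d : ℕ} (K : Fin (d + 1) → ℕ) [hK : ∀ μ, NeZero (K μ)]
variable {𝕜 : Type*} [RCLike 𝕜] {n : Type*} [Fintype n] [DecidableEq n]

/-! ## §1 Parity-periodic functions: `T_μ² = 4`, `S² = 4(d+1)` -/

section Square

omit [Fintype n] [DecidableEq n] hK in
/-- The KS hopping `T_μ` as a `𝕜`-LINEAR MAP. [folklore] -/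
def ksTₗ (μ : Fin (d + 1)) : (Tor K × n → 𝕜) →ₗ[𝕜] (Tor K × n → 𝕜) where
  toFun := ksT K μ
  map_add' v w := by funext ⟨x, i⟩; simp only [ksT_apply, Pi.add_apply]; ring
  map_smul' a v := by funext ⟨x, i⟩; simp only [ksT_apply, Pi.smul_apply, smul_eq_mul, RingHom.id_apply]; ring

omit [Fintype n] [DecidableEq n] hK in
/-- `ksTₗ μ v = ksT μ v`. [folklore] -/
@[simp] theorem ksTₗ_apply (μ : Fin (d + 1)) (v : Tor K × n → 𝕜) : ksTₗ K μ v = ksT K μ v := rfl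

omit [Fintype n] [DecidableEq n] hK in
/-- `T_μ(Σ_ν f_ν) = Σ_ν T_μ f_ν`. [folklore] -/
theorem ksT_sum (μ : Fin (d + 1)) (f : Fin (d + 1) → Tor K × n → 𝕜) : ksT K μ (∑ ν, f ν) = ∑ ν, ksT K μ (f ν) := by
  rw [← ksTₗ_apply, map_sum]; simp only [ksTₗ_apply]

/-- PARITY-PERIODIC functions: `v(x + e_μ + e_μ, i) = v(x, i)` for every direction (functions of the parity class of `x`). [folklore] -/
def IsParityPeriodic (v : Tor K × n → 𝕜) : Prop := ∀ x μ i, v (x + unitVec K μ + unitVec K μ, i) = v (x, i)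

omit [RCLike 𝕜] [Fintype n] [DecidableEq n] hK in
/-- … equivalently backwards: `v(x − e_μ − e_μ) = v(x)`. [folklore] -/
theorem IsParityPeriodic.sub {v : Tor K × n → 𝕜} (hv : IsParityPeriodic K v) (x : Tor K) (μ : Fin (d + 1)) (i : n) : v (x - unitVec K μ - unitVec K μ, i) = v (x, i) := by
  have h := hv (x - unitVec K μ - unitVec K μ) μ i
  rw [sub_add_cancel, sub_add_cancel] at h
  exact h.symm

omit [Fintype n] [DecidableEq n] hK in
/-- ★ `T_μ(T_μv) = 4v` on parity-periodic `v` (`η_μ(x ± e_μ) = η_μ(x)`, `η_μ² = 1`, `v(x ± 2e_μ) = v(x)`). [folklore] -/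
theorem ksT_ksT_self {v : Tor K × n → 𝕜} (hv : IsParityPeriodic K v) (μ : Fin (d + 1)) : ksT K μ (ksT K μ v) = (4 : 𝕜) • v := by
  funext ⟨x, i⟩
  simp only [ksT_apply, Pi.smul_apply, smul_eq_mul, ksSgn_add_unitVec_self, ksSgn_sub_unitVec_self]
  rw [hv x μ i, hv.sub K x μ i, add_sub_cancel_right, sub_add_cancel]
  have hs := ksSgn_mul_self K (𝕜 := 𝕜) μ x
  linear_combination (2 * v (x, i) + v (x, i) + v (x, i)) * hs

/-- THE TOTAL KS HOPPING `S = Σ_μ T_μ`. [cite: King1986, (4.4) p.670] -/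
def ksS (v : Tor K × n → 𝕜) : Tor K × n → 𝕜 := ∑ μ, ksT K μ v

omit [Fintype n] [DecidableEq n] in
/-- ★★ **`S(Sv) = 4(d+1)·v` ON PARITY-PERIODIC `v`** (all `K` even): `S² = Σ_μT_μ² + Σ_{μ≠ν}T_μT_ν`, the diagonal is `4(d+1)` by `ksT_ksT_self`, the off-diagonal pairs cancel by Ϳ-e
`ksT_anticomm` — the Clifford relation of the staggered hoppings. [cite: King1986, (2.12) p.653, (4.4) p.670] -/
theorem ksS_ksS (hK2 : ∀ μ, Even (K μ)) {v : Tor K × n → 𝕜} (hv : IsParityPeriodic K v) : ksS K (ksS K v) = (4 * ((d : 𝕜) + 1)) • v := by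
  unfold ksS
  simp only [ksT_sum]
  -- A := Σ_μ Σ_ν T_μ T_ν v;  A = Σ_μ Σ_ν T_ν T_μ v by renaming; so 2A = Σ_μ Σ_ν (T_μT_ν + T_νT_μ) v = Σ_μ 2 T_μ² v
  set A : Tor K × n → 𝕜 := ∑ μ, ∑ ν, ksT K μ (ksT K ν v) with hA
  have hA' : A = ∑ μ, ∑ ν, ksT K ν (ksT K μ v) := by rw [hA, Finset.sum_comm]
  have h2A : A + A = ∑ μ : Fin (d + 1), (2 * (4 : 𝕜)) • v := by
    calc A + A = A + ∑ μ, ∑ ν, ksT K ν (ksT K μ v) := by rw [← hA']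
      _ = ∑ μ : Fin (d + 1), (2 * (4 : 𝕜)) • v := by
        rw [hA, ← Finset.sum_add_distrib]
        refine Finset.sum_congr rfl fun μ _ => ?_
        rw [← Finset.sum_add_distrib, Finset.sum_eq_single μ]
        · rw [ksT_ksT_self K hv μ, ← add_smul]; norm_num
        · intro ν _ hνμ
          rw [ksT_anticomm K hK2 (Ne.symm hνμ), neg_add_cancel]
        · intro h; exact absurd (Finset.mem_univ μ) h
  rw [Finset.sum_const, Finset.card_univ, Fintype.card_fin, ← Nat.cast_smul_eq_nsmul 𝕜, smul_smul] at h2A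
  have h2 : (2 : 𝕜) • A = (((d + 1 : ℕ) : 𝕜) * (2 * 4)) • v := by rw [two_smul, h2A]
  have h2' : A = ((2 : 𝕜)⁻¹ * (((d + 1 : ℕ) : 𝕜) * (2 * 4))) • v := by
    rw [← smul_smul, ← h2, smul_smul, inv_mul_cancel₀ (two_ne_zero), one_smul]
  rw [h2']
  congr 1
  push_cast; ring

omit [Fintype n] [DecidableEq n] in
/-- `T_μ` preserves parity-periodicity (`K_μ` even is not needed here: translations commute). [folklore] -/
theorem isParityPeriodic_ksT {v : Tor K × n → 𝕜} (hv : IsParityPeriodic K v) (μ : Fin (d + 1)) (hK2 : ∀ μ, Even (K μ)) : IsParityPeriodic K (ksT K μ v) := by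
  intro x ν i
  simp only [ksT_apply]
  have hη : ksSgn K (𝕜 := 𝕜) μ (x + unitVec K ν + unitVec K ν) = ksSgn K μ x := by
    by_cases h : ν < μ
    · rw [ksSgn_add_unitVec_of_lt K h (hK2 ν), ksSgn_add_unitVec_of_lt K h (hK2 ν), neg_neg]
    · rw [ksSgn_add_unitVec_of_not_lt K h, ksSgn_add_unitVec_of_not_lt K h]
  rw [hη, show x + unitVec K ν + unitVec K ν + unitVec K μ = x + unitVec K μ + unitVec K ν + unitVec K ν by abel,
    show x + unitVec K ν + unitVec K ν - unitVec K μ = x - unitVec K μ + unitVec K ν + unitVec K ν by abel, hv, hv]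

omit [Fintype n] [DecidableEq n] in
/-- `S` preserves parity-periodicity. [folklore] -/
theorem isParityPeriodic_ksS {v : Tor K × n → 𝕜} (hv : IsParityPeriodic K v) (hK2 : ∀ μ, Even (K μ)) : IsParityPeriodic K (ksS K v) := by
  intro x ν i
  simp only [ksS, Finset.sum_apply]
  exact Finset.sum_congr rfl fun μ _ => isParityPeriodic_ksT K hv μ hK2 x ν i

end Square

/-! ## §2 The eigenvectors `w_± = Sv ± 2√(d+1)·v` -/

section Eigvec

omit [Fintype n] [DecidableEq n] hK in
/-- `S` is additive and homogeneous (a sum of linear maps). [folklore] -/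
theorem ksS_add_smul (v w : Tor K × n → 𝕜) (a : 𝕜) : ksS K (v + a • w) = ksS K v + a • ksS K w := by
  unfold ksS
  simp only [← ksTₗ_apply, map_add, map_smul, Finset.sum_add_distrib, Finset.smul_sum]

omit [Fintype n] [DecidableEq n] in
/-- `(2√(d+1))² = 4(d+1)` in `𝕜`. [folklore] -/
theorem two_sqrt_sq : (((2 * Real.sqrt ((d : ℝ) + 1) : ℝ)) : 𝕜) * (((2 * Real.sqrt ((d : ℝ) + 1) : ℝ)) : 𝕜) = 4 * ((d : 𝕜) + 1) := by
  rw [← RCLike.ofReal_mul, show (2 * Real.sqrt ((d : ℝ) + 1)) * (2 * Real.sqrt ((d : ℝ) + 1)) = 4 * (Real.sqrt ((d : ℝ) + 1) * Real.sqrt ((d : ℝ) + 1)) by ring,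
    Real.mul_self_sqrt (by positivity)]
  push_cast; ring

omit [Fintype n] [DecidableEq n] in
/-- ★★★ **THE `+` EIGENVECTOR OF `S`**: for parity-periodic `v`, `S(Sv + 2√(d+1)·v) = 2√(d+1)·(Sv + 2√(d+1)·v)` (`S²v = 4(d+1)v`). [cite: King1986, (4.4) p.670] -/
theorem ksS_eigvec_plus (hK2 : ∀ μ, Even (K μ)) {v : Tor K × n → 𝕜} (hv : IsParityPeriodic K v) :
    ksS K (ksS K v + (((2 * Real.sqrt ((d : ℝ) + 1) : ℝ)) : 𝕜) • v) = (((2 * Real.sqrt ((d : ℝ) + 1) : ℝ)) : 𝕜) • (ksS K v + (((2 * Real.sqrt ((d : ℝ) + 1) : ℝ)) : 𝕜) • v) := by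
  rw [ksS_add_smul, ksS_ksS K hK2 hv, smul_add, smul_smul, two_sqrt_sq]
  exact add_comm _ _

omit [Fintype n] [DecidableEq n] in
/-- ★★★ **THE `−` EIGENVECTOR OF `S`**: `S(Sv − 2√(d+1)·v) = −2√(d+1)·(Sv − 2√(d+1)·v)`. [cite: King1986, (4.4) p.670] -/
theorem ksS_eigvec_minus (hK2 : ∀ μ, Even (K μ)) {v : Tor K × n → 𝕜} (hv : IsParityPeriodic K v) :
    ksS K (ksS K v + (-(((2 * Real.sqrt ((d : ℝ) + 1) : ℝ)) : 𝕜)) • v) = (-(((2 * Real.sqrt ((d : ℝ) + 1) : ℝ)) : 𝕜)) • (ksS K v + (-(((2 * Real.sqrt ((d : ℝ) + 1) : ℝ)) : 𝕜)) • v) := by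
  rw [ksS_add_smul, ksS_ksS K hK2 hv, smul_add, smul_smul, neg_mul_neg, two_sqrt_sq]
  exact add_comm _ _

/-- ★★★ **EIGENVECTORS OF `−cΔ_U+m²` AT THE KS FIELD**: if `Sw = σ·w` then `(−cΔ_U+m²)w = (m² + 2(d+1)c − cσ)·w` (King's stencil Ϳ-e `covLapF_ks_mulVec`).
[cite: King1986, (4.4) p.670; Balaban1985BackgroundPropagators, (3.23) p.394] -/
theorem covLapF_ks_mulVec_of_ksS_eq (c m2 : ℝ) {w : Tor K × n → 𝕜} {σ : 𝕜} (hw : ksS K w = σ • w) :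
    covLapF K c m2 (ksLink K) *ᵥ w = (((m2 + 2 * ((d : ℝ) + 1) * c : ℝ) : 𝕜) - (c : 𝕜) * σ) • w := by
  funext ⟨x, i⟩
  have hS : (∑ μ, ksT K μ w (x, i)) = σ * w (x, i) := by
    have := congr_fun hw (x, i)
    rw [ksS, Finset.sum_apply, Pi.smul_apply, smul_eq_mul] at this
    exact this
  rw [covLapF_ks_mulVec, hS, Pi.smul_apply, smul_eq_mul]
  ring

end Eigvec

/-! ## §3 A concrete parity-periodic vector and the exact band -/

section Exact

/-- THE PARITY INDICATOR `Π_μ(1 + (−1)^{x_μ})·e_i`: `2^{d+1}·e` on the all-even parity class, `0` elsewhere (Ϳ-d's sublattice signs `subSgn`). [folklore] -/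
def parInd (e : n → 𝕜) : Tor K × n → 𝕜 := fun p => (∏ μ, (1 + subSgn K μ p.1)) * e p.2

omit [Fintype n] [DecidableEq n] in
/-- The parity indicator is parity-periodic (`(−1)^{x_μ+2} = (−1)^{x_μ}` for `K_μ` even; other coordinates untouched). [folklore] -/
theorem isParityPeriodic_parInd (hK2 : ∀ μ, Even (K μ)) (e : n → 𝕜) : IsParityPeriodic K (parInd K e) := by
  intro x μ i
  simp only [parInd]
  congr 1
  refine Finset.prod_congr rfl fun ν _ => ?_
  by_cases h : ν = μ
  · subst h; rw [subSgn_add_unitVec_self K (hK2 ν), subSgn_add_unitVec_self K (hK2 ν), neg_neg]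
  · rw [subSgn_add_unitVec_of_ne K (Ne.symm h), subSgn_add_unitVec_of_ne K (Ne.symm h)]

omit [Fintype n] [DecidableEq n] hK in
/-- At the origin: `parInd e (0,i) = 2^{d+1}·e_i`. [folklore] -/
theorem parInd_zero (e : n → 𝕜) (i : n) : parInd K e (0, i) = (2 : 𝕜) ^ (d + 1) * e i := by
  simp only [parInd, subSgn, Pi.zero_apply, ZMod.val_zero, pow_zero]
  norm_num

omit [Fintype n] [DecidableEq n] in
/-- One step off the origin the indicator vanishes: `parInd e (±e_μ, i) = 0` (the `μ`-th factor is `1 + (−1) = 0`, `K_μ` even). [folklore] -/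
theorem parInd_unitVec (hK2 : ∀ μ, Even (K μ)) (e : n → 𝕜) (μ : Fin (d + 1)) (i : n) :
    parInd K e (0 + unitVec K μ, i) = 0 ∧ parInd K e (0 - unitVec K μ, i) = 0 := by
  have h0 : subSgn K (𝕜 := 𝕜) μ 0 = 1 := by simp [subSgn]
  constructor
  · simp only [parInd]
    rw [Finset.prod_eq_zero (Finset.mem_univ μ) (by rw [subSgn_add_unitVec_self K (hK2 μ), h0, add_neg_cancel]), zero_mul]
  · simp only [parInd]
    rw [Finset.prod_eq_zero (Finset.mem_univ μ) (by rw [subSgn_sub_unitVec_self K (hK2 μ), h0, add_neg_cancel]), zero_mul]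

omit [Fintype n] [DecidableEq n] in
/-- `S(parInd)` vanishes at the origin (all its neighbours lie in odd classes). [folklore] -/
theorem ksS_parInd_zero (hK2 : ∀ μ, Even (K μ)) (e : n → 𝕜) (i : n) : ksS K (parInd K e) (0, i) = 0 := by
  simp only [ksS, Finset.sum_apply, ksT_apply]
  refine Finset.sum_eq_zero fun μ _ => ?_
  rw [(parInd_unitVec K hK2 e μ i).1, (parInd_unitVec K hK2 e μ i).2, add_zero, mul_zero]

omit [Fintype n] [DecidableEq n] in
/-- The eigenvectors `w_±` are non-zero for `e ≠ 0`: `w_±(0,i) = ±2√(d+1)·2^{d+1}·e_i`. [folklore] -/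
theorem eigvec_ne_zero (hK2 : ∀ μ, Even (K μ)) {e : n → 𝕜} (he : e ≠ 0) {a : 𝕜} (ha : a ≠ 0) : ksS K (parInd K e) + a • parInd K e ≠ 0 := by
  obtain ⟨i, hi⟩ := Function.ne_iff.mp he
  refine Function.ne_iff.mpr ⟨(0, i), ?_⟩
  rw [Pi.add_apply, Pi.smul_apply, ksS_parInd_zero K hK2, zero_add, parInd_zero, smul_eq_mul, Pi.zero_apply]
  exact mul_ne_zero ha (mul_ne_zero (pow_ne_zero _ two_ne_zero) hi)

omit [Fintype n] [DecidableEq n] hK in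
/-- `2√(d+1) ≠ 0` in `𝕜`. [folklore] -/
theorem two_sqrt_ne_zero : (((2 * Real.sqrt ((d : ℝ) + 1) : ℝ)) : 𝕜) ≠ 0 := by
  exact_mod_cast (mul_pos two_pos (Real.sqrt_pos.mpr (by positivity : (0 : ℝ) < (d : ℝ) + 1))).ne'

variable {c : ℝ}

/-- ★★★ **THE BOTTOM IS ATTAINED**: some eigenvalue of `−cΔ_U+m²` at the KS field equals `m² + (2(d+1) − 2√(d+1))c` (non-trivial fibre; eigenvector `w_+ = S·parInd + 2√(d+1)·parInd`).
[cite: DodziukMathai2006, Cor 1.3 §1; King1986, (4.4) p.670; tHooft1979Flux, NPB 153 (flux sectors, notion)] -/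
theorem exists_eigenvalue_covLapF_ks_eq_bottom [Nonempty n] (c m2 : ℝ) (hK2 : ∀ μ, Even (K μ)) :
    ∃ i, (isHermitian_covLapF K c m2 (ksLink K (n := n) (𝕜 := 𝕜))).eigenvalues i = m2 + (2 * ((d : ℝ) + 1) - 2 * Real.sqrt ((d : ℝ) + 1)) * c := by
  classical
  obtain ⟨j⟩ := ‹Nonempty n›
  have he : (Pi.single j (1 : 𝕜) : n → 𝕜) ≠ 0 := Function.ne_iff.mpr ⟨j, by simp⟩
  refine exists_eigenvalues_eq_of_mulVec (isHermitian_covLapF K c m2 _) (eigvec_ne_zero K hK2 he (two_sqrt_ne_zero (d := d))) ?_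
  rw [covLapF_ks_mulVec_of_ksS_eq K c m2 (ksS_eigvec_plus K hK2 (isParityPeriodic_parInd K hK2 _))]
  congr 1
  push_cast; ring

/-- ★★★ **THE TOP IS ATTAINED**: some eigenvalue equals `m² + (2(d+1) + 2√(d+1))c` (eigenvector `w_− = S·parInd − 2√(d+1)·parInd`). [cite: King1986, (4.4) p.670; DodziukMathai2006, Cor 1.3 §1] -/
theorem exists_eigenvalue_covLapF_ks_eq_top [Nonempty n] (c m2 : ℝ) (hK2 : ∀ μ, Even (K μ)) :
    ∃ i, (isHermitian_covLapF K c m2 (ksLink K (n := n) (𝕜 := 𝕜))).eigenvalues i = m2 + (2 * ((d : ℝ) + 1) + 2 * Real.sqrt ((d : ℝ) + 1)) * c := by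
  classical
  obtain ⟨j⟩ := ‹Nonempty n›
  have he : (Pi.single j (1 : 𝕜) : n → 𝕜) ≠ 0 := Function.ne_iff.mpr ⟨j, by simp⟩
  refine exists_eigenvalues_eq_of_mulVec (isHermitian_covLapF K c m2 _) (eigvec_ne_zero K hK2 he (neg_ne_zero.mpr (two_sqrt_ne_zero (d := d)))) ?_
  rw [covLapF_ks_mulVec_of_ksS_eq K c m2 (ksS_eigvec_minus K hK2 (isParityPeriodic_parInd K hK2 _))]
  congr 1
  push_cast; ring

/-- ★★★ **THE KOGUT–SUSSKIND BAND IS EXACT**: at the maximal-flux `ℤ₂` field (all `K` even, `c ≥ 0`, non-trivial fibre) every eigenvalue of `−cΔ_U+m²` lies in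
`[m² + (2(d+1)−2√(d+1))c, m² + (2(d+1)+2√(d+1))c]` and BOTH end points are eigenvalues — Ϳ-e's anticommutation bound is sharp on both sides.
[cite: DodziukMathai2006, Cor 1.3 §1; King1986, (4.4) p.670; tHooft1979Flux, NPB 153 (flux sectors, notion)] -/
theorem ks_spectral_band_exact [Nonempty n] (hc : 0 ≤ c) (m2 : ℝ) (hK2 : ∀ μ, Even (K μ)) :
    (∀ i, m2 + (2 * ((d : ℝ) + 1) - 2 * Real.sqrt ((d : ℝ) + 1)) * c ≤ (isHermitian_covLapF K c m2 (ksLink K (n := n) (𝕜 := 𝕜))).eigenvalues i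
        ∧ (isHermitian_covLapF K c m2 (ksLink K (n := n) (𝕜 := 𝕜))).eigenvalues i ≤ m2 + (2 * ((d : ℝ) + 1) + 2 * Real.sqrt ((d : ℝ) + 1)) * c)
      ∧ (∃ i, (isHermitian_covLapF K c m2 (ksLink K (n := n) (𝕜 := 𝕜))).eigenvalues i = m2 + (2 * ((d : ℝ) + 1) - 2 * Real.sqrt ((d : ℝ) + 1)) * c)
      ∧ (∃ i, (isHermitian_covLapF K c m2 (ksLink K (n := n) (𝕜 := 𝕜))).eigenvalues i = m2 + (2 * ((d : ℝ) + 1) + 2 * Real.sqrt ((d : ℝ) + 1)) * c) :=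
  ⟨fun i => ⟨eigenvalues_covLapF_ks_ge K hc m2 hK2 i, eigenvalues_covLapF_ks_le K hc m2 hK2 i⟩, exists_eigenvalue_covLapF_ks_eq_bottom K c m2 hK2,
    exists_eigenvalue_covLapF_ks_eq_top K c m2 hK2⟩

/-- In four dimensions (`d+1 = 4`): the band is `[m² + 4c, m² + 12c]` (`2·4 ∓ 2√4 = 8 ∓ 4`). [folklore] -/
theorem ks_band_four : (2 * ((3 : ℝ) + 1) - 2 * Real.sqrt ((3 : ℝ) + 1) = 4) ∧ (2 * ((3 : ℝ) + 1) + 2 * Real.sqrt ((3 : ℝ) + 1) = 12) := by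
  have h : Real.sqrt ((3 : ℝ) + 1) = 2 := by rw [show ((3 : ℝ) + 1) = 2 ^ 2 by norm_num, Real.sqrt_sq (by norm_num)]
  rw [h]; norm_num

end Exact

end Summit.QuantumFields.YangMills.BalabanUVNodes.N15KingModelRung.Curvature

end
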